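import Summits.ResolutionOfSingularities.ResolutionOfSingularities.Theorems.HilbertSamuelEliminationSigmaMaxModificationsCorridor3WLadderStrataLabels
import Literature.AlgebraicGeometry.CossartJannsenSaito2020.KeyTheoremsLocal
import Literature.AlgebraicGeometry.CossartJannsenSaito2020.NearPointDirectrix
import Literature.AlgebraicGeometry.CossartJannsenSaito2020.NearPointProjDirectrix
import Literature.AlgebraicGeometry.Resolution.PermissibleBlowupDirectrix
import Literature.AlgebraicGeometry.Resolution.OneDimensionalBlowupTower
import HarnessLib

/-!
# [OURS · L1 W4.2] The H-LAYER (generic-point descent), part 1/2 — DEFINITIONS: moving lineages, local near-point chains,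
# the kill row `LocalNearPointChainsTerminate`, its printed binders `LocalPrintedFacts`, and the transfer row
# `MovingLineageLocalizesM p`

Crux chain w42 (`SigmaMaxModifications`, stmt-ResolutionOfSingularities-18506; skeleton `w_ladder` v6 on
`SigmaMaxModificationsCorridor3`, stmt-ResolutionOfSingularities-19249), W4.2 DEAL of res-L1-w42-plan-1 (2026-08-27 07:34:07Z)
object D1 (ii) «H-LAYER»: land res-L1-w42-idea-2's card-H line `L/res-L1-w42-idea-2/Line-wtop-product.lean` v2.1
(sha16 ea8a854e4ebcec71; card `idea-generic-point-descent.md`; res-L1-w42-tri-2 TRIAGE v5.1 row R5-H SURVIVES-MODULO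
⟨`MovingLineageLocalizesM p`⟩ ∧ ⟨`LocalPrintedFacts`⟩) WITHOUT its two `stub_*`, as campaign vocabulary of the tree. This file is
the DEFINITIONS half (typer res-type-040); the PROVED compositions into the tree's rows are part 2/2
(`…Corridor3WLadderLocalChains`). OURS (cell res-hironaka, slot W4.2); NOT statements of H. Hironaka's manuscript [Hironaka2017]
nor of [CossartJannsenSaito2020]; AI-drafted, weaker than expert review. Helper file `--supports stmt-ResolutionOfSingularities-19249`.

## The mechanism in one paragraph (idea-2 card H: CJS's own move «one dimension down», Lemma 6.30 / p. 98 Step 9, as two rows)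

A moving chain `x_0 ← x_1 ← ⋯` of canonical near steps that is NEVER isolated in `X_n(ν)` rides positive-dimensional irreducible
components `Z_n ∋ x_n` of the strata. The strata-half of the W-ladder was reduced (p500484, p503069 / p503885; any `Q`, any `G`)
to rows (b) `StrataBirthsSettle`, (c-rep) `StrataReplayBlowupsSettle` and THE DIMENSION-TWO KERNEL (c-geo)
`StrataLineageInCentreIO`: «no dominating lineage `Z_{n+1} ↠ Z_n` through the chain points lies inside the canonical centre at
infinitely many stages». The H-layer closes (c-geo) at level `3` — for EVERY `Q` and EVERY `G` — from two rows and print: at the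
generic points `η_n = η_{Z_n}`, a lineage hit infinitely often IS an infinite chain of blow-ups of the CLOSED point of the
excellent LOCAL scheme `Spec 𝒪_{X_n,η_n}` of dimension `≤ 2`, each followed to a NEAR CLOSED point ISOLATED in the Hilbert–Samuel
locus of the next local scheme (TRANSFER row `MovingLineageLocalizesM p`, technique B: localisation is a flat base change with
regular fibres, Prop. 6.31's easiest case) — and such chains are finite by the printed dimension-2 theory read on `Spec 𝒪_{X,x}`
as p. 107 directs (p. 98 Step 9: `e = 0` no near point, Thm. 3.14; `e = 1` tails finite, Cor. 6.37; `e = 2` forces `ē = 2` in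
dimension `2`, and chains of fundamental units of length `1` with isolated initial parts are finite, Thm. 6.40 — KILL row
`LocalNearPointChainsTerminate`, M modulo its five PRINTED binders `LocalPrintedFacts`), in EVERY characteristic
(`CharHypothesis` is automatic in dimension `≤ 2`: `charHypothesis_of_dim_le_two`, PROVED). The grade `ē_{x_n}` of the CLOSED
chain points never enters: the descent is by CODIMENSION, not by grade.

## Contents (namespace `…Theorems.SigmaMaxModificationsCorridor3.Moving`; identifiers = idea-2 v2.1 VERBATIM)

* §1 `IsMovingLineage R N ν c Z` (= the negated body of stub-4's (c-geo), named) and PROVED `IsMovingLineage.isBlownUp_io`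
  (a lineage hit infinitely often makes the chain moving — whence `ν ≠ Φ^{(N)}` inside the transfer, by
  `IsMaximalOrigin.not_isBlownUp_of_eq_iterPSum` of `…Corridor3RegularValue`).
* §2 downstairs: `IsLocalNearPointStep`, `IsLocalNearPointChain`, the KILL row `LocalNearPointChainsTerminate` — with
  res-L1-w42-tri-2's SHARPENING (TRIAGE v5.1 R5-H (3)(K-c)/(a)): level clause `topologicalKrullDim (S 0) < N` in place of v2.1's
  `≤ N` (Singh-free: u.s.c. along specialisations is used with `ψ < N`; the composition uses the row only at `N = 3 > 2 ≥ dim S_0`,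
  so nothing downstream changes) —, its five printed binders `LocalPrintedFacts`, PROVED `charHypothesis_of_dim_le_two`.
* §3 the TRANSFER row `MovingLineageLocalizesM p` (verbatim).
* §4 (rev 2, res-L1-w42-plan-1 ruling «D6 — BINDER RULING = (α)» 2026-08-27 07:51:11Z on res-D-pv-046's D6 PACE #1 FINDING)
  `LocalChainPrintedFacts` = the kill row's printed binders WITH the point-centre LOCUS form of Thm. 3.14 (`Thm314_point_locus`,
  `…NearPointProjDirectrix`, p503241) as SIXTH conjunct; the five-conjunct `LocalPrintedFacts` of rev 1 (p512269) is DEPRECATED in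
  its favour (append-only discipline: deprecate-and-add, the rev-1 declaration is byte-identical). D6's target reads
  `theorem localNearPointChainsTerminate_of_printedFacts : LocalChainPrintedFacts → LocalNearPointChainsTerminate`.
* NOT landed here (W4.2 DEAL: «REUSE, never restate»): v2.1's by-value copies `QNonptd` / `EvNonIso₃` / `RecIso₃` — part 2/2
  imports res-type-012's `IdeasL1Idea2R4.QNonpointed` / `WtopEvNonIsoM` / `WtopRecIsoM` (`…Corridor3WLadderMovingIsoDefs`, p500943).

Consumers by name (W4.2 DEAL D3 / D6): `theorem movingLineageLocalizesM_holds (p) : MovingLineageLocalizesM p` (res-type-053,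
`…Corridor3WLadderLocalChainsLocalize`), `theorem localNearPointChainsTerminate_of_printedFacts : LocalPrintedFacts →
LocalNearPointChainsTerminate` (res-D-pv-046, `…Corridor3WLadderLocalChainsTerminate`).

References: CJS LNM 2270 Lemma 6.30 (proof via the localisation `X_η`, p. 97), p. 98 Step 9, Prop. 6.31, Rem. 6.29 (1), Thm. 3.14,
Thm. 3.10 (4), Lemma 3.15 (1), Cor. 6.37, Def. 6.38/6.39, Thm. 6.40, Rem. 6.41, p. 105, p. 107 [CossartJannsenSaito2020]; Kollár,
Lectures on Resolution of Singularities, Thm. 1.101 [Kollar2007]; tree `…WLadderStrataLineages` (p500484), `…WLadderStrataLabels`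
(p503069), `Literature…KeyTheoremsLocal`, `…NearPointDirectrix` (p499700), `…PermissibleBlowupDirectrix` (p499783),
`…OneDimensionalBlowupTower`; HOME/L/w42/CHAIN.md v3.10 / CRUX-PLAN v3.6; L/res-L1-w42-idea-2/idea-generic-point-descent.md;
L/res-L1-w42-tri-2/TRIAGE-v5.1.md R5-H; L/res-L1-w42-tri-1/TRIAGE.md R3-N.
-/

noncomputable section

-- plan-1/idea-2 module setting kept (namespace `…Corridor3.Moving` re-enters `…Corridor3`)
set_option linter.dupNamespace false

open CategoryTheory AlgebraicGeometry TopologicalSpace Topology IsLocalRing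
open Summit.ResolutionOfSingularities.ResolutionOfSingularities.Theorems.CampaignW42
open Literature.AlgebraicGeometry.Resolution Literature.RingTheory.HilbertSamuel
open Literature.AlgebraicGeometry.CossartJannsenSaito2020
open Summit.ResolutionOfSingularities.ResolutionOfSingularities.Theorems.SigmaMaxModificationsCorridor3

universe u

namespace Summit.ResolutionOfSingularities.ResolutionOfSingularities.Theorems.SigmaMaxModificationsCorridor3.Moving

variable {R : ∀ S : Scheme.{u}, CentreSeq S → Prop} {N : ℕ} {ν : ℕ → ℕ}

/-! ## §1. Lineages hit at their generic points -/

/-- [OURS · L1 W4.2] **A MOVING LINEAGE along a chain of marked stages** — verbatim the data negated by stub-4's row (c-geo)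
`StrataLineageInCentreIO` (p503069): `Z n` an irreducible component of `X_n(ν)` through `x_n`, `Z (n+1)` DOMINATING `Z n` under a
step projection, and `Z m` inside the centre of the canonical step from `X_m` for infinitely many `m` (there the centre, regular and
inside `X(ν) ⊇ Z`, IS `Z` at the generic point `η_Z`: the step is the blow-up of the closed point of `Spec 𝒪_{X_m,η_{Z_m}}`).
NOT a statement of the manuscript. [cite: CossartJannsenSaito2020, Rem. 6.29 (1), Lemma 6.30] -/
def IsMovingLineage (R : ∀ S : Scheme.{u}, CentreSeq S → Prop) (N : ℕ) (ν : ℕ → ℕ) (c : ℕ → MarkedStage.{u})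
    (Z : ∀ n, Set (c n).W) : Prop :=
  (∀ n, Z n ∈ componentsThrough N ν (c n)) ∧
  (∀ n, ∃ f : (c (n + 1)).W ⟶ (c n).W, StepProjection R N ν (c n) (c (n + 1)) f ∧ closure (f.base '' Z (n + 1)) = Z n) ∧
  ∀ n, ∃ m, n ≤ m ∧ ∃ (C : (c m).W.IdealSheafData) (P' : Option (Pending (blowup C))),
    IsCanonicalStep R N ν (c m).L (c m).P C P' ∧ Z m ⊆ (C.support : Set (c m).W)

/-- A chain carrying a moving lineage is moving (its marked point is blown up infinitely often); with
`IsMaximalOrigin.not_isBlownUp_of_eq_iterPSum` (module `…Corridor3RegularValue`) this gives `ν ≠ Φ^{(N)}` along such a chain. [folklore] -/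
theorem IsMovingLineage.isBlownUp_io {c : ℕ → MarkedStage.{u}} {Z : ∀ n, Set (c n).W}
    (hZ : IsMovingLineage R N ν c Z) : ∀ n, ∃ m, n ≤ m ∧ (c m).IsBlownUp R N ν := by
  intro n
  obtain ⟨m, hnm, C, P', hcs, hZC⟩ := hZ.2.2 n
  exact ⟨m, hnm, C, P', hcs, hZC (hZ.1 m).2⟩

/-! ## §2. Downstairs: local near-point chains on excellent schemes of dimension ≤ 2 -/

/-- [OURS · L1 W4.2] **ONE LOCAL NEAR-POINT STEP**: `S` is local at `s` (`S ≅ Spec 𝒪_{S,s}`), `π : B ⟶ S` is the blow-up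
of `S` in its closed point (the centre's stalk at `s` is `𝔪_s`, which pins the centre on a local scheme), `b ∈ B` is a CLOSED
point over `s` with the SAME Hilbert–Samuel function at level `N` (near), and `(S', s')` is the local scheme of `B` at `b`
(Def. 6.38 with `m = 1` read locally as p. 107 directs, WITHOUT the clause `e = ē = 2`). NOT a statement of the manuscript.
[cite: CossartJannsenSaito2020, Def. 6.38, p. 107] [cite: Kollar2007, Def. 1.97] -/
def IsLocalNearPointStep (N : ℕ) (S : Scheme.{u}) (s : S) (S' : Scheme.{u}) (s' : S') : Prop :=
  IsLocalAt S s ∧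
  ∃ (B : Scheme.{u}) (π : B ⟶ S) (D : S.IdealSheafData) (b : B),
    IsBlowup π D ∧ stalkIdeal D s = maximalIdeal (S.presheaf.stalk s) ∧ π.base b = s ∧
      Scheme.hsFun B N b = Scheme.hsFun S N s ∧ IsClosed ({b} : Set B) ∧ IsLocalSchemeAt S' s' B b

/-- [OURS · L1 W4.2] **An infinite chain of local near-point steps** `(S_0, s_0) ← (S_1, s_1) ← ⋯`.
NOT a statement of the manuscript. [cite: CossartJannsenSaito2020, Def. 6.39, p. 107] -/
def IsLocalNearPointChain (N : ℕ) (S : ℕ → Scheme.{u}) (pt : ∀ i, S i) : Prop :=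
  ∀ i, IsLocalNearPointStep N (S i) (pt i) (S (i + 1)) (pt (i + 1))

/-- [OURS · L1 W4.2] **KILL ROW — local near-point chains with ISOLATED points on reduced excellent schemes of dimension
`≤ 2` are finite** (CJS p. 98 Step 9, read on the local scheme as p. 107 directs). If `S_0` is excellent, reduced, of dimension
`≤ 2` and `< N` (the level — res-L1-w42-tri-2's SHARPENING of idea-2 v2.1's `≤ N`, TRIAGE v5.1 R5-H (3)(K-c): upper
semicontinuity along specialisations is available for `ψ < N`, the boundary level `N = dim S_0` being Singh's case; the
composition `strataLineageInCentreIO_of_localChains` uses the row only at `N = 3 > 2`), there is no infinite chain of local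
near-point steps in which every `s_i` is isolated in the Hilbert–Samuel locus of `S_i`. Intended proof, all from print:
`e_{s_i} ≤ dim S_i ≤ 2` and `e ≤ ē ≤ 2`; `e = 0` admits no near point (Thm. 3.14); an `e = 1` point has at most one near point, with
the same residue field, so `e` stays `≤ 1` (Thm. 3.14, Thm. 3.10 (4)) and the tail is the fundamental sequence over it, finite by
Cor. 6.37 (`Corollary637_char_loc`); `e = 2` forces `ē = 2`, the whole `ℙ(Dir) ≅ ℙ¹` is never near (its generic point would generize
the next chain point inside the Hilbert–Samuel locus, against isolation), so every step is a fundamental unit of LENGTH `1` with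
isolated initial part and an `e = ē = 2` tail is excluded by Thm. 6.40 (`KeyTheorem640_char_localized_isolated`); dimension `≤ 1`:
the same facts (their `KeySetting` = excellent ∧ `dim ≤ N` has no lower dimension bound; CJS Thm. 1.1 is stated for dimension
`≤ 2`), or INDEPENDENTLY Kollár's Thm. 1.101 in local-chain form (`Kollar2007_thm_1_101_localChain`, the fifth conjunct of
`LocalPrintedFacts`; its hypothesis «reduced completion» from excellent + reduced by the tree's `OneDimAnalyticallyUnramified`): a
reduced `1`-dimensional germ becomes regular after boundedly many local quadratic transforms, and a REGULAR `1`-dimensional germ is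
not isolated in its Hilbert–Samuel locus (its generic points carry the same normalised value), so the chain's isolation hypothesis
fails there — at dimension `1` «isolated in the HS-max locus» MEANS «singular», non-vacuously (res-L1-w42-tri-1 caution (v), checked
against `IsIsolatedInHSMaxLocus := ∃ U, IsOpen U ∧ U ∩ hsMaxLocus = {x}`: on a local scheme the only open set through the closed
point is everything). On a local AFFINE scheme the ideal sheaf `D` of a step is determined by its stalk `𝔪_s` at the closed point,
so `supp D = {s}` (tri-1 caution (ii)) is automatic. `CharHypothesis` is automatic (`charHypothesis_of_dim_le_two`); `KeySetting` /
units of the relocalised stages by res-type-053's `keySetting_localize`, `isFundamentalUnit_localize` (p498279, p504210).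
Hypothesis audit (tri-2 TRIAGE v5.1 R5-H (4)): excellence is LOAD-BEARING (an analytically ramified 1-dimensional local domain
carries an infinite chain), isolation is load-bearing (`z² = x³yⁿ`), the level clause is load-bearing (`N = 0` on a regular local
surface); `IsReduced (S 0)` possibly unnecessary, harmless. Why it might fail: only through a mismatch with the typed F-keys' fine
print (unit data `e = ē = 2` at BOTH ends, the `InducesIsoOn`/`permissible` clauses of `IsFundamentalUnit` on a length-1 unit), not
mathematically; a further PRINTED binder may be added per res-L1-w42-plan-1 RULINGS v3.9-2 (F). OURS row (M modulo
`LocalPrintedFacts`); NOT a statement of the manuscript. References (prose, on purpose): CJS LNM 2270 p. 98 Step 9, Thm. 3.14,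
Thm. 3.10 (4), Cor. 6.37, Thm. 6.40, Rem. 6.41, p. 107; Kollár 2007 Thm. 1.101. (OURS node — parameterless `Prop`, deliberately
untagged so that the gate does not relocate it to `Literature/`, precedent p496180 `BirthTidy`; not a citation of print; not
asserted.) -/
def LocalNearPointChainsTerminate : Prop :=
  ∀ (N : ℕ) (S : ℕ → Scheme.{u}) (ln : ∀ i, IsLocallyNoetherian (S i)) (pt : ∀ i, S i),
    Scheme.IsExcellent (S 0) → IsReduced (S 0) →
    topologicalKrullDim ↥(S 0) ≤ (2 : WithBot ℕ∞) → topologicalKrullDim ↥(S 0) < (N : WithBot ℕ∞) →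
    IsLocalNearPointChain N S pt → (∀ i, @IsIsolatedInHSMaxLocus (S i) (ln i) N (pt i)) → False

/-- **The five PRINTED binders of the kill row** (named facts of the tree, statement-only lane, all printed theorems —
admissible binders per res-L1-w42-plan-1 RULINGS v3.9-2 (F)): [CossartJannsenSaito2020] Cor. 6.37 and Thm. 6.40 over a local
scheme (`KeyTheoremsLocal`, p. 107), Thm. 3.14 (p499700) and Thm. 3.10 (4) (p499783); and, for the dimension-`1` nodes
independently of the CJS keys' dimension range, [Kollar2007] Thm. 1.101 in local-chain form (`OneDimensionalBlowupTower`, F-45;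
the prover may ignore it if the CJS keys as typed suffice — idea-2 v2.1, answer to plan-1 RULINGS v3.10-2 (δ)). References
(prose, on purpose): CJS LNM 2270 Cor. 6.37, Thm. 6.40, Thm. 3.14, Thm. 3.10 (4), p. 107; Kollár 2007 Thm. 1.101 — the five
conjuncts ARE the tree's tagged named facts. (OURS bundle — parameterless `Prop`, deliberately untagged so that the gate does not
relocate it to `Literature/`, precedent p496180; not itself a citation of print; not asserted.) -/
def LocalPrintedFacts : Prop :=
  Corollary637_char_loc.{u} ∧ KeyTheorem640_char_localized_isolated.{u} ∧
    CossartJannsenSaito2020_thm_3_14.{u} ∧ CossartJannsenSaito2020_thm_3_10_4.{u} ∧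
    Literature.AlgebraicGeometry.Resolution.Kollar2007_thm_1_101_localChain.{u}

/-- **`CharHypothesis` is automatic in dimension `≤ 2`** (`d + 2 ≤ 2·p` for every prime `p` once `d ≤ 2`): the formal reason the
downstairs kill is characteristic-free. [cite: CossartJannsenSaito2020, Thm. 10.2, Cor. 1.5] -/
theorem charHypothesis_of_dim_le_two {X : Scheme.{u}} (x : X) {d : ℕ}
    (hd : topologicalKrullDim ↥X = (d : WithBot ℕ∞)) (hd2 : d ≤ 2) : CharHypothesis X x := by
  refine ⟨d, hd, ?_⟩
  rcases CharP.char_is_prime_or_zero (ResidueField (X.presheaf.stalk x))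
      (ringChar (ResidueField (X.presheaf.stalk x))) with h | h
  · exact Or.inr (by have := h.two_le; omega)
  · exact Or.inl h

/-! ## §3. The transfer row (technique B) -/

/-- [OURS · L1 W4.2] **TRANSFER ROW (technique B) — A MOVING LINEAGE LOCALISES TO A LOCAL NEAR-POINT CHAIN.** At level `3`:
for every functional admissible oracle, maximal origin of characteristic `p`, chain of canonical near steps from it that is never
isolated, and MOVING lineage `Z` along it, there is an infinite chain of local near-point steps `(S_i, s_i)` with `S_0` excellent,
reduced, of dimension `≤ 2`, every `s_i` isolated in the Hilbert–Samuel locus of `S_i`. Construction: `ν ≠ Φ^{(3)}`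
(`isBlownUp_io` + `IsMaximalOrigin.not_isBlownUp_of_eq_iterPSum`), so the cycle package of the tree applies (permissible, regular,
reduced centres inside `X(ν)`); pass to the tail on which `dim Z_n` is constant (it is non-decreasing and `≤ 2`); along the hit
stages `m_0 < m_1 < ⋯` put `S_i = Spec 𝒪_{X_{m_i}, η_{Z_{m_i}}}`; at a hit the centre is regular, inside `X(ν)`, and contains the
COMPONENT `Z` of `X(ν)`, so its stalk at `η_Z` is `𝔪_{η_Z}` and the step base-changes along the flat `fromSpecStalk`
(`flat_fromSpecStalk`, `IsBlowup.pullback_snd_of_flat`) to the blow-up of the closed point; `η_{Z_{m_i+1}}` gives a point over it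
(`mem_range_pullback_fst_fromSpecStalk_of_eq`), CLOSED in its fibre because `dim Z` is constant (res-L1-w42-tri-2 TRIAGE v5.1
R5-H (5), fibre-formula-free route: a proper specialisation `z` of `η_{Z_{m+1}}` over `η_{Z_m}` has `H(z) = ν` by u.s.c. at level
`3` and `ν` maximal, so `z ∈ Z_{m+1}` and `dim Z_{m+1} ≥ 1 + dim Z_m` — against the constant-dimension tail), NEAR because
`Z ⊆ X(ν)` (`Scheme.hsFun_eq_of_isIso_stalkMap`, `isIso_stalkMap_pullback_fst_fromSpecStalk`); the steps strictly between hits are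
isomorphisms at `η_Z` (`IsBlowup.isIso_stalkMap_of_notMem_closure`), whence `IsLocalSchemeAt`; isolation because a proper
generization of `η_Z` with the same `H` would be the generic point of a larger irreducible subset of `X(ν)` (`ν` maximal, Thm. 2.33
u.s.c.); excellence / reducedness / `dim ≤ 2`: `isExcellentRing_stalk_of_isExcellent` (p500227), reduced origin and blow-ups, and
`codim η_Z ≥ 1` for a positive-dimensional component (never isolated ⇒ `{x_n}` is not a component) in `dim X_n ≤ 3`
(`IsBlowup.topologicalKrullDim_le`). Tools: lead-1's `…Corridor3ChainTower` (chain ↦ `BlowupTower`, `isBlowup_chainProj`),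
`Literature…MaxStratumStrictTransform` (Lemma 3.15 (1)). Why it might fail: bookkeeping only (no manuscript mathematics); the
delicate clause is «CLOSED in its fibre». OURS row (M); NOT a statement of the manuscript. Prover of record: res-type-053
(W4.2 DEAL D3, `movingLineageLocalizesM_holds`).
[cite: CossartJannsenSaito2020, Lemma 6.30, Prop. 6.31, Lemma 3.15 (1), p. 107] [cite: GortzWedhorn2020, Prop. 13.91 (2)] -/
def MovingLineageLocalizesM (p : ℕ) : Prop :=
  ∀ (R : ∀ S : Scheme.{u}, CentreSeq S → Prop), OracleFunctional R → OracleAdmissible R →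
  ∀ (ν : ℕ → ℕ) (X : Scheme.{u}) [IsLocallyNoetherian X] (x : X), IsMaximalOrigin p 3 ν X x →
  ∀ c : ℕ → MarkedStage.{u}, Reaches R 3 ν (MarkedStage.init X x) (c 0) →
    (∀ n, CanonicalNearStep R 3 ν (c n) (c (n + 1))) → (∀ n, ¬ Iso 3 (c n)) →
    ∀ Z : ∀ n, Set (c n).W, IsMovingLineage R 3 ν c Z →
      ∃ (S : ℕ → Scheme.{u}) (ln : ∀ i, IsLocallyNoetherian (S i)) (pt : ∀ i, S i),
        Scheme.IsExcellent (S 0) ∧ IsReduced (S 0) ∧ topologicalKrullDim ↥(S 0) ≤ (2 : WithBot ℕ∞) ∧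
        IsLocalNearPointChain 3 S pt ∧ ∀ i, @IsIsolatedInHSMaxLocus (S i) (ln i) 3 (pt i)

/-! ## §4. rev 2 — the kill row's printed binders with the LOCUS form of Thm. 3.14 (plan-1 ruling (α)) -/

/-- **The six PRINTED binders of the kill row** (rev 2; supersedes the five-conjunct `LocalPrintedFacts` of rev 1, which is
deprecated below): [CossartJannsenSaito2020] Cor. 6.37 and Thm. 6.40 over a local scheme (`KeyTheoremsLocal`, p. 107), Thm. 3.14
numerical (p499700) and Thm. 3.10 (4) (p499783), [Kollar2007] Thm. 1.101 in local-chain form (`OneDimensionalBlowupTower`, F-45 —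
res-D-pv-046 reports it UNUSED on the intended proof of the kill; kept, harmless), and SIXTH — res-L1-w42-plan-1 ruling «D6 — BINDER
RULING = (α)» (2026-08-27 07:51:11Z) on res-D-pv-046's D6 PACE #1 FINDING — CJS Thm. 3.14 in its point-centre LOCUS form
`Thm314_point_locus` (`…NearPointProjDirectrix`, p503241; a PRINTED theorem, admissible under RULINGS v3.9-2 (F) «a further
PRINTED binder may be added»), needed twice on the `e = 1` branch of the kill: e-STABILITY at `e = 1 < ē` (the near point lies on
`ℙ(Dir)`, a single `κ`-rational point by `ProjDir_line` — now a THEOREM, `projDir_line` p509891, hence no binder — so Thm. 3.10 (4)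
gives `e′ ≤ e = 1`), and the RECOGNITION of the fundamental sequence for `Corollary637_char_loc` (Def. 6.34 (i)/(ii); cf.
res-L1-w42-stub-2's `false_of_localTower_grade_one` p509395 with its binder `h314pt`). Consumer by name (W4.2 DEAL D6):
`theorem localNearPointChainsTerminate_of_printedFacts : LocalChainPrintedFacts → LocalNearPointChainsTerminate` (res-D-pv-046,
`…Corridor3WLadderLocalChainsTerminate`); card H's frame reads `Wtop3NonpointedM p ⟸ LocalChainPrintedFacts ∧ (T) ∧ (K) ∧
WtopRecIsoM p QNonpointed ∧ (b)₃ ∧ (c-rep)₃`. References (prose, on purpose): CJS LNM 2270 Cor. 6.37, Thm. 6.40, Thm. 3.14,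
Thm. 3.10 (4), Def. 6.34, p. 103, p. 107; Kollár 2007 Thm. 1.101 — the six conjuncts ARE the tree's tagged named facts. (OURS bundle —
parameterless `Prop`, deliberately untagged so that the gate does not relocate it to `Literature/`, precedent p496180; not itself a
citation of print; not asserted.) -/
def LocalChainPrintedFacts : Prop :=
  Corollary637_char_loc.{u} ∧ KeyTheorem640_char_localized_isolated.{u} ∧
    CossartJannsenSaito2020_thm_3_14.{u} ∧ CossartJannsenSaito2020_thm_3_10_4.{u} ∧
    Literature.AlgebraicGeometry.Resolution.Kollar2007_thm_1_101_localChain.{u} ∧ Thm314_point_locus.{u}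

/-- The rev-2 bundle gives the rev-1 bundle (drop the sixth conjunct). [folklore] -/
theorem LocalChainPrintedFacts.toFive (h : LocalChainPrintedFacts.{u}) :
    Corollary637_char_loc.{u} ∧ KeyTheorem640_char_localized_isolated.{u} ∧
      CossartJannsenSaito2020_thm_3_14.{u} ∧ CossartJannsenSaito2020_thm_3_10_4.{u} ∧
      Literature.AlgebraicGeometry.Resolution.Kollar2007_thm_1_101_localChain.{u} :=
  ⟨h.1, h.2.1, h.2.2.1, h.2.2.2.1, h.2.2.2.2.1⟩

/-- The point-centre locus form of Thm. 3.14 is the sixth conjunct. [folklore] -/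
theorem LocalChainPrintedFacts.thm314_point_locus (h : LocalChainPrintedFacts.{u}) : Thm314_point_locus.{u} :=
  h.2.2.2.2.2

-- rev 1's five-conjunct bundle is superseded (plan-1 ruling (α)); deprecate-and-add, append-only.
attribute [deprecated LocalChainPrintedFacts (since := "2026-08-27")] LocalPrintedFacts

end Summit.ResolutionOfSingularities.ResolutionOfSingularities.Theorems.SigmaMaxModificationsCorridor3.Moving
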